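import Mathlib

/-!
# SoloBlind — quadratic resolvent NORM bound (kernel #173, s83; the B12 two-constants certificate)

Companion of `SoloBlindQuadraticResolvent` (kernel #172, the algebraic factorisation
`(1 - M) * (1 + M - T) = (1 - T) - (M * M - T * M)`).  Here the scalar case `T = t • 1` is carried to an
explicit OPERATOR-NORM bound in a complete normed algebra with `‖1‖ = 1`:

* `soloBlind_inverse_scalar_sub` : if `‖Q‖ ≤ a < ‖1 - t‖` then `(1 - t) • 1 - Q` has a two-sided inverse `e`
  with `‖e‖ ≤ 1 / (‖1 - t‖ - a)` (Neumann series);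
* `soloBlind_quadratic_resolvent_bound` : if `‖M * M - t • M‖ ≤ a < ‖1 - t‖` then `1 - M` has a two-sided
  inverse of norm `≤ (1 + ‖M‖ + ‖t‖) / (‖1 - t‖ - a)`.

This is the inequality the B12 slit certificate evaluates (with `t = tr M(P)` the trace of the truncated
monodromy, `N₂(P) = ‖M² - t M‖` and `|1 - t| ≥ 1 - e^{-K₀T/2} - |t - e^{-K₀T/2}|`): the resonance factor
`‖(1 - M(P))⁻¹‖` is bounded by `(1 + ‖M(P)‖ + |t|) / (|1 - t| - N₂(P))` wherever `N₂(P) < |1 - t|`.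
-/

namespace Summit.AnomalousDissipation.AnomalousDissipation.Theorems

section

variable {𝕜 : Type*} [NontriviallyNormedField 𝕜] {R : Type*} [NormedRing R] [NormedAlgebra 𝕜 R]
  [CompleteSpace R] [NormOneClass R]

/-- Neumann inverse of `(1 - t) • 1 - Q` with the explicit norm bound `1 / (‖1 - t‖ - ‖Q‖)`. -/
theorem soloBlind_inverse_scalar_sub (t : 𝕜) (Q : R) (a : ℝ) (hQ : ‖Q‖ ≤ a)
    (ha : a < ‖(1 : 𝕜) - t‖) :
    ∃ e : R, ((1 - t) • (1 : R) - Q) * e = 1 ∧ e * ((1 - t) • (1 : R) - Q) = 1 ∧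
      ‖e‖ ≤ 1 / (‖(1 : 𝕜) - t‖ - a) := by
  have ha0 : 0 ≤ a := le_trans (norm_nonneg Q) hQ
  have hpos : 0 < ‖(1 : 𝕜) - t‖ := lt_of_le_of_lt ha0 ha
  have hne : (1 : 𝕜) - t ≠ 0 := norm_pos_iff.mp hpos
  set n : ℝ := ‖(1 : 𝕜) - t‖ with hn
  set s : 𝕜 := ((1 : 𝕜) - t)⁻¹ with hs
  set x : R := s • Q with hx
  have hxn : ‖x‖ * n ≤ a := by
    rw [hx, norm_smul, hs, norm_inv, ← hn, mul_comm, ← mul_assoc, mul_inv_cancel₀ (ne_of_gt hpos),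
      one_mul]
    exact hQ
  have hx1 : ‖x‖ < 1 := by
    by_contra hge
    push Not at hge
    have : n ≤ ‖x‖ * n := le_mul_of_one_le_left hpos.le hge
    linarith
  set w : R := ∑' i : ℕ, x ^ i with hw
  have hw1 : (1 - x) * w = 1 := mul_neg_geom_series x hx1
  have hw2 : w * (1 - x) = 1 := geom_series_mul_neg x hx1
  have hwn : ‖w‖ ≤ (1 - ‖x‖)⁻¹ := by
    have h := tsum_geometric_le_of_norm_lt_one x hx1
    rw [norm_one, sub_self, zero_add] at h
    exact h
  have hfac : (1 - t) • (1 : R) - Q = (1 - t) • ((1 : R) - x) := by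
    rw [hx, smul_sub, smul_smul, hs, mul_inv_cancel₀ hne, one_smul]
  refine ⟨s • w, ?_, ?_, ?_⟩
  · rw [hfac, smul_mul_assoc, mul_smul_comm, smul_smul, hs, mul_inv_cancel₀ hne, one_smul, hw1]
  · rw [hfac, smul_mul_assoc, mul_smul_comm, smul_smul, hs, inv_mul_cancel₀ hne, one_smul, hw2]
  · have hxlt : 0 < 1 - ‖x‖ := by linarith
    have hna : 0 < n - a := by linarith
    have hkey : n - a ≤ n * (1 - ‖x‖) := by nlinarith
    calc ‖s • w‖ = n⁻¹ * ‖w‖ := by rw [norm_smul, hs, norm_inv]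
      _ ≤ n⁻¹ * (1 - ‖x‖)⁻¹ := by
          exact mul_le_mul_of_nonneg_left hwn (inv_nonneg.mpr hpos.le)
      _ = 1 / (n * (1 - ‖x‖)) := by rw [one_div, mul_inv]
      _ ≤ 1 / (n - a) := one_div_le_one_div_of_le hna hkey

/-- **B12 resonance-factor bound.**  If `‖M * M - t • M‖ ≤ a < ‖1 - t‖` then `1 - M` is two-sidedly invertible
with `‖(1 - M)⁻¹‖ ≤ (1 + ‖M‖ + ‖t‖) / (‖1 - t‖ - a)`; the inverse is `(1 + M - t • 1) * e` with `e` the Neumann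
inverse of `(1 - t) • 1 - (M * M - t • M)`. -/
theorem soloBlind_quadratic_resolvent_bound (M : R) (t : 𝕜) (a : ℝ) (hN : ‖M * M - t • M‖ ≤ a)
    (ha : a < ‖(1 : 𝕜) - t‖) :
    ∃ f : R, (1 - M) * f = 1 ∧ f * (1 - M) = 1 ∧ ‖f‖ ≤ (1 + ‖M‖ + ‖t‖) / (‖(1 : 𝕜) - t‖ - a) := by
  obtain ⟨e, h1, h2, he⟩ := soloBlind_inverse_scalar_sub t (M * M - t • M) a hN ha
  have ha0 : 0 ≤ a := le_trans (norm_nonneg _) hN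
  have hna : 0 < ‖(1 : 𝕜) - t‖ - a := by linarith
  -- the commuting scalar `T = t • 1`, kept opaque for `noncomm_ring`
  obtain ⟨T, hTdef⟩ : ∃ T : R, T = t • (1 : R) := ⟨_, rfl⟩
  have hTM : T * M = t • M := by rw [hTdef, smul_mul_assoc, one_mul]
  have hMT : M * T = t • M := by rw [hTdef, mul_smul_comm, mul_one]
  have hkey : (1 - T) - (M * M - t • M) = (1 - t) • (1 : R) - (M * M - t • M) := by
    rw [hTdef, sub_smul, one_smul]
  have hfl : (1 - M) * (1 + M - T) = (1 - T) - (M * M - t • M) := by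
    have h : (1 - M) * (1 + M - T) = (1 - T) - (M * M - M * T) := by noncomm_ring
    rw [h, hMT]
  have hfr : (1 + M - T) * (1 - M) = (1 - T) - (M * M - t • M) := by
    have h : (1 + M - T) * (1 - M) = (1 - T) - (M * M - T * M) := by noncomm_ring
    rw [h, hTM]
  have hR : (1 - M) * ((1 + M - T) * e) = 1 := by
    rw [← mul_assoc, hfl, hkey, h1]
  have hL : (e * (1 + M - T)) * (1 - M) = 1 := by
    rw [mul_assoc, hfr, hkey, h2]
  have heq : e * (1 + M - T) = (1 + M - T) * e := by
    calc e * (1 + M - T)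
        = (e * (1 + M - T)) * ((1 - M) * ((1 + M - T) * e)) := by rw [hR, mul_one]
      _ = ((e * (1 + M - T)) * (1 - M)) * ((1 + M - T) * e) := by simp only [mul_assoc]
      _ = (1 + M - T) * e := by rw [hL, one_mul]
  refine ⟨(1 + M - T) * e, hR, ?_, ?_⟩
  · rw [← heq]; exact hL
  · have hT : ‖T‖ = ‖t‖ := by rw [hTdef, norm_smul, norm_one, mul_one]
    have hA : ‖1 + M - T‖ ≤ 1 + ‖M‖ + ‖t‖ := by
      calc ‖1 + M - T‖ ≤ ‖1 + M‖ + ‖T‖ := norm_sub_le _ _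
        _ ≤ (‖(1 : R)‖ + ‖M‖) + ‖T‖ := by gcongr; exact norm_add_le _ _
        _ = 1 + ‖M‖ + ‖t‖ := by rw [norm_one, hT]
    calc ‖(1 + M - T) * e‖ ≤ ‖1 + M - T‖ * ‖e‖ := norm_mul_le _ _
      _ ≤ (1 + ‖M‖ + ‖t‖) * (1 / (‖(1 : 𝕜) - t‖ - a)) :=
          mul_le_mul hA he (norm_nonneg _) (by positivity)
      _ = (1 + ‖M‖ + ‖t‖) / (‖(1 : 𝕜) - t‖ - a) := by rw [mul_one_div]

end

end Summit.AnomalousDissipation.AnomalousDissipation.Theorems
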